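import Summits.Langlands.Langlands.Theorems.QuadraticWindowHostInducedRepAsaiLocalIdentity

/-!
# The local Asai identity in a biquadratic tower, Ib: the three fibre products —
helper file 4 for stub `stub_asaiPoleInduced` of line `one-transparent-pane`
(crux `Summit.Langlands.Langlands.Theses.QuadraticWindow.HostInducedRep`, item stmt-Langlands-10902)

LOG (worker `stub_asaiPoleInduced`).  FACT-FREE.  Continuation of `AsaiLocalIdentity` (same setting:
`F₀ ⊆ K ⊆ L`, `[L:K] = 2` with involution `t`, a quadratic subextension `F₀ ⊆ E' ⊆ L` with involution
`θ`, `θ₀ = θ|^{F₀}`, `t₀ = t|^{F₀}` generating the Klein group `Gal(L/F₀)`; `v` a place of `F₀` unramified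
in `L`, `w₀ | v`).  The product of the unramified `(L/E', θ)`-Asai factors of a Satake family `A'` over
`L` over the places of `E'` above `v`, in the three positions of `D_{w₀}` relative to `θ₀`
(`X = q_v^{-z}`):

* `inertiaDeg_eq_two_of_some_fixed`, `inertiaDeg_eq_one_of_none_fixed` — `f(w₀|v)` from
  `f(w₀|v) · #{w | v} = 4`;
* `tprod_fibre_of_fixed` (`θ w₀ = w₀`): two places `v'`, inert in `L`, `q_{v'} = q_v`:
  `P^η(A' w₀)(X)⁻¹ · P^η(A' (t w₀))(X)⁻¹`;
* `tprod_fibre_of_one` (`θ w₀ ≠ w₀`, `t w₀ = w₀` or `θ t w₀ = w₀`): one place, split, `q_{v'} = q_v²`: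
  `det(1 - A' w₀ ⊗ A' (θ w₀) X²)⁻¹`;
* `tprod_fibre_of_none` (`D_{w₀} = 1`): two places, split, `q_{v'} = q_v`:
  `det(1 - A' w₀ ⊗ A'(θw₀) X)⁻¹ det(1 - A'(tw₀) ⊗ A'(θtw₀) X)⁻¹`.
LANDING LOG (wave 3): registered anchor `asaiFibreProducts_anchor` at the end.  [folklore]
-/

set_option linter.dupNamespace false -- project-wide option (lakefile weak.linter.dupNamespace); `Summit.Langlands.Langlands` is the mandated namespace

open scoped Classical
open Literature.NumberTheory.Automorphic
open Summit.Langlands.Langlands.Theorems.HostInducedRep.Negative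
open IsDedekindDomain NumberField Polynomial

namespace Summit.Langlands.Langlands.Theorems.HostInducedRep.OneTransparentPane

section Products

variable {F₀ K E' L : Type} [Field F₀] [NumberField F₀] [Field K] [Field E'] [NumberField E']
  [Field L] [NumberField L] [Algebra F₀ K] [Algebra K L] [Algebra F₀ L] [IsScalarTower F₀ K L]
  [Algebra F₀ E'] [Algebra E' L] [IsScalarTower F₀ E' L]

omit [NumberField F₀] [NumberField E'] [NumberField L] in
/-- `θ • t • w₀ = w₀ ↔ t • w₀ = θ • w₀` for the involution `θ`. [folklore] -/
theorem smul_smul_eq_iff {t : L ≃ₐ[K] L} {θ : L ≃ₐ[E'] L}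
    (hθθ : θ.restrictScalars F₀ * θ.restrictScalars F₀ = 1) (w₀ : HeightOneSpectrum (𝓞 L)) :
    θ • t • w₀ = w₀ ↔ t • w₀ = θ • w₀ := by
  rw [← HeightOneSpectrum.restrictScalars_smul (F := F₀) θ, ← HeightOneSpectrum.restrictScalars_smul (F := F₀) θ,
    ← HeightOneSpectrum.restrictScalars_smul (F := F₀) t]
  constructor
  · intro h
    calc t.restrictScalars F₀ • w₀
        = (θ.restrictScalars F₀ * θ.restrictScalars F₀) • t.restrictScalars F₀ • w₀ := by
          rw [hθθ, one_smul]
      _ = θ.restrictScalars F₀ • θ.restrictScalars F₀ • t.restrictScalars F₀ • w₀ := mul_smul _ _ _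
      _ = θ.restrictScalars F₀ • w₀ := by rw [h]
  · intro h
    rw [h, smul_smul, hθθ, one_smul]

omit [NumberField F₀] [NumberField E'] [NumberField L] in
/-- `θ • t • w₀ = t • w₀ ↔ θ • w₀ = w₀` when `θ t = t θ`. [folklore] -/
theorem smul_smul_eq_smul_iff {t : L ≃ₐ[K] L} {θ : L ≃ₐ[E'] L}
    (hcomm : θ.restrictScalars F₀ * t.restrictScalars F₀ = t.restrictScalars F₀ * θ.restrictScalars F₀)
    (w₀ : HeightOneSpectrum (𝓞 L)) :
    θ • t • w₀ = t • w₀ ↔ θ • w₀ = w₀ := by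
  rw [← HeightOneSpectrum.restrictScalars_smul (F := F₀) θ, ← HeightOneSpectrum.restrictScalars_smul (F := F₀) θ,
    ← HeightOneSpectrum.restrictScalars_smul (F := F₀) t,
    show θ.restrictScalars F₀ • t.restrictScalars F₀ • w₀ = t.restrictScalars F₀ • θ.restrictScalars F₀ • w₀ by
      rw [smul_smul, smul_smul, hcomm], smul_left_cancel_iff]

omit [NumberField E'] in
/-- **`f(w₀|v) = 2` when `D_{w₀}` has order `2`**, in the three positions `θ₀ ∈ D`, `t₀ ∈ D`,
`θ₀t₀ ∈ D`: the places above `v` are two, `{w₀, tw₀}` resp. `{w₀, θw₀}`. [folklore] -/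
theorem inertiaDeg_eq_two_of_some_fixed (h4 : Module.finrank F₀ L = 4) (h2K : Module.finrank K L = 2)
    (h2E : Module.finrank E' L = 2) {t : L ≃ₐ[K] L} {θ : L ≃ₐ[E'] L} (ht : t ≠ 1) (hθ : θ ≠ 1)
    (hθt : θ.restrictScalars F₀ ≠ t.restrictScalars F₀)
    (hθt1 : θ.restrictScalars F₀ * t.restrictScalars F₀ ≠ 1)
    {w₀ : HeightOneSpectrum (𝓞 L)} (hv : Algebra.IsUnramifiedIn (𝓞 L) (w₀.under (𝓞 F₀)).asIdeal)
    (hfix : t • w₀ = w₀ ∨ θ • w₀ = w₀ ∨ θ • t • w₀ = w₀) :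
    w₀.asIdeal.inertiaDeg (𝓞 F₀) = 2 := by
  obtain ⟨ht₀, hθ₀, htt, hθθ, hcomm⟩ := klein_relations h4 h2K h2E ht hθ hθt hθt1
  have hexcl := not_smul_eq_and_smul_eq h4 ht₀ hθ₀ hθt hθt1 htt hθθ (w := w₀) hv
  rw [HeightOneSpectrum.restrictScalars_smul, HeightOneSpectrum.restrictScalars_smul] at hexcl
  have hmul := inertiaDeg_mul_card_eq_four h4 ht₀ hθ₀ hθt hθt1 (w₀ := w₀) hv
  suffices hcard : ({w₀, t • w₀, θ • w₀, θ • t • w₀} : Finset (HeightOneSpectrum (𝓞 L))).card = 2 by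
    rw [hcard] at hmul; omega
  rcases hfix with h | h | h
  · -- `t w₀ = w₀`, `θ w₀ ≠ w₀`
    have hθw : θ • w₀ ≠ w₀ := fun h' => hexcl ⟨h, h'⟩
    rw [h, show ({w₀, w₀, θ • w₀, θ • w₀} : Finset (HeightOneSpectrum (𝓞 L))) = {w₀, θ • w₀} by
      ext x; simp only [Finset.mem_insert, Finset.mem_singleton]; tauto]
    exact Finset.card_pair (Ne.symm hθw)
  · -- `θ w₀ = w₀`, `t w₀ ≠ w₀`, `θ t w₀ = t w₀`
    have htw : t • w₀ ≠ w₀ := fun h' => hexcl ⟨h', h⟩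
    rw [(smul_smul_eq_smul_iff hcomm w₀).mpr h, h,
      show ({w₀, t • w₀, w₀, t • w₀} : Finset (HeightOneSpectrum (𝓞 L))) = {w₀, t • w₀} by
        ext x; simp only [Finset.mem_insert, Finset.mem_singleton]; tauto]
    exact Finset.card_pair (Ne.symm htw)
  · -- `θ t w₀ = w₀`, `t w₀ = θ w₀ ≠ w₀`
    have htθ : t • w₀ = θ • w₀ := (smul_smul_eq_iff hθθ w₀).mp h
    have htw : t • w₀ ≠ w₀ := fun h' => hexcl ⟨h', htθ ▸ h'⟩
    rw [h, ← htθ, show ({w₀, t • w₀, t • w₀, w₀} : Finset (HeightOneSpectrum (𝓞 L))) = {w₀, t • w₀} by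
      ext x; simp only [Finset.mem_insert, Finset.mem_singleton]; tauto]
    exact Finset.card_pair (Ne.symm htw)

omit [NumberField E'] in
/-- **`f(w₀|v) = 1` when `D_{w₀} = 1`**: the four places `w₀, tw₀, θw₀, θtw₀` are distinct. [folklore] -/
theorem inertiaDeg_eq_one_of_none_fixed (h4 : Module.finrank F₀ L = 4) (h2K : Module.finrank K L = 2)
    (h2E : Module.finrank E' L = 2) {t : L ≃ₐ[K] L} {θ : L ≃ₐ[E'] L} (ht : t ≠ 1) (hθ : θ ≠ 1)
    (hθt : θ.restrictScalars F₀ ≠ t.restrictScalars F₀)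
    (hθt1 : θ.restrictScalars F₀ * t.restrictScalars F₀ ≠ 1)
    {w₀ : HeightOneSpectrum (𝓞 L)} (hv : Algebra.IsUnramifiedIn (𝓞 L) (w₀.under (𝓞 F₀)).asIdeal)
    (htw : t • w₀ ≠ w₀) (hθw : θ • w₀ ≠ w₀) (hθtw : θ • t • w₀ ≠ w₀) :
    w₀.asIdeal.inertiaDeg (𝓞 F₀) = 1 := by
  obtain ⟨ht₀, hθ₀, htt, hθθ, hcomm⟩ := klein_relations h4 h2K h2E ht hθ hθt hθt1
  have hmul := inertiaDeg_mul_card_eq_four h4 ht₀ hθ₀ hθt hθt1 (w₀ := w₀) hv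
  have h₁ : t • w₀ ≠ θ • w₀ := fun h => hθtw ((smul_smul_eq_iff hθθ w₀).mpr h)
  have h₂ : θ • t • w₀ ≠ t • w₀ := fun h => hθw ((smul_smul_eq_smul_iff hcomm w₀).mp h)
  have h₃ : θ • t • w₀ ≠ θ • w₀ := fun h => htw (smul_left_cancel θ h)
  have hcard : ({w₀, t • w₀, θ • w₀, θ • t • w₀} : Finset (HeightOneSpectrum (𝓞 L))).card = 4 := by
    rw [Finset.card_insert_of_notMem, Finset.card_insert_of_notMem, Finset.card_pair h₃.symm]
    · simp only [Finset.mem_insert, Finset.mem_singleton, not_or]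
      exact ⟨h₁, h₂.symm⟩
    · simp only [Finset.mem_insert, Finset.mem_singleton, not_or]
      exact ⟨htw.symm, hθw.symm, hθtw.symm⟩
  rw [hcard] at hmul
  omega

/-- The unramified Asai factor of the Satake family `A'` over `L` w.r.t. `(L/E', θ)` at the sign `η`,
below the place `v'` of `E'`, at `z`: `det(1 - As^η(t_{v'}) q_{v'}^{-z})⁻¹`. [folklore] -/
theorem asaiFactor_placeAbove_under (h2E : Module.finrank E' L = 2) {θ : L ≃ₐ[E'] L} (hθ : θ ≠ 1)
    (A' : SatakeFamily L) (η : ℤˣ) (z : ℂ) (w : HeightOneSpectrum (𝓞 L)) :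
    ((asaiLocalPolynomial θ A' η (placeAbove L (w.under (𝓞 E')))).eval
        ((((w.under (𝓞 E')).residueCard : ℕ) : ℂ) ^ (-z)))⁻¹ =
      ((asaiLocalPolynomial θ A' η w).eval ((((w.under (𝓞 E')).residueCard : ℕ) : ℂ) ^ (-z)))⁻¹ := by
  rw [asaiLocalPolynomial_placeAbove_under h2E hθ]

/-- **Case `θ ∈ D_{w₀}`**: the product of the `(L/E', θ)`-Asai factors over the places of `E'` above `v`
is `P^η(A' w₀)(X)⁻¹ · P^η(A'(tw₀))(X)⁻¹`, `X = q_v^{-z}` (two places `w₀ ∩ E' ≠ tw₀ ∩ E'`, both inert in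
`L` with `q = q_v`). [folklore] -/
theorem tprod_fibre_of_fixed (h4 : Module.finrank F₀ L = 4) (h2K : Module.finrank K L = 2)
    (h2E : Module.finrank E' L = 2) {t : L ≃ₐ[K] L} {θ : L ≃ₐ[E'] L} (ht : t ≠ 1) (hθ : θ ≠ 1)
    (hθt : θ.restrictScalars F₀ ≠ t.restrictScalars F₀)
    (hθt1 : θ.restrictScalars F₀ * t.restrictScalars F₀ ≠ 1)
    {w₀ : HeightOneSpectrum (𝓞 L)} {v : HeightOneSpectrum (𝓞 F₀)} (hw₀ : w₀.under (𝓞 F₀) = v)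
    (hvL : Algebra.IsUnramifiedIn (𝓞 L) v.asIdeal)
    (hvE : ∀ v' : HeightOneSpectrum (𝓞 E'), v'.under (𝓞 F₀) = v → Algebra.IsUnramifiedIn (𝓞 L) v'.asIdeal)
    (A' : SatakeFamily L) (η : ℤˣ) (z : ℂ) (hθw : θ • w₀ = w₀) :
    ∏' v' : {v' : HeightOneSpectrum (𝓞 E') // v'.under (𝓞 F₀) = v},
        ((asaiLocalPolynomial θ A' η (placeAbove L v'.1)).eval (((v'.1.residueCard : ℕ) : ℂ) ^ (-z)))⁻¹ =
      ((asaiInertPolynomial η (A' w₀)).eval (((v.residueCard : ℕ) : ℂ) ^ (-z)))⁻¹ *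
        ((asaiInertPolynomial η (A' (t • w₀))).eval (((v.residueCard : ℕ) : ℂ) ^ (-z)))⁻¹ := by
  obtain ⟨ht₀, hθ₀, htt, hθθ, hcomm⟩ := klein_relations h4 h2K h2E ht hθ hθt hθt1
  have hv₀ : Algebra.IsUnramifiedIn (𝓞 L) (w₀.under (𝓞 F₀)).asIdeal := hw₀ ▸ hvL
  have hexcl := not_smul_eq_and_smul_eq h4 ht₀ hθ₀ hθt hθt1 htt hθθ (w := w₀) hv₀
  rw [HeightOneSpectrum.restrictScalars_smul, HeightOneSpectrum.restrictScalars_smul] at hexcl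
  have htw : t • w₀ ≠ w₀ := fun h' => hexcl ⟨h', hθw⟩
  have hθtw : θ • t • w₀ = t • w₀ := (smul_smul_eq_smul_iff hcomm w₀).mpr hθw
  have hf : w₀.asIdeal.inertiaDeg (𝓞 F₀) = 2 :=
    inertiaDeg_eq_two_of_some_fixed h4 h2K h2E ht hθ hθt hθt1 hv₀ (Or.inr (Or.inl hθw))
  have hft : (t • w₀).asIdeal.inertiaDeg (𝓞 F₀) = 2 := by
    rw [← HeightOneSpectrum.restrictScalars_smul (F := F₀), HeightOneSpectrum.inertiaDeg_algEquiv_smul, hf]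
  have htv : (t • w₀).under (𝓞 F₀) = v := by
    rw [← HeightOneSpectrum.restrictScalars_smul (F := F₀), HeightOneSpectrum.under_algEquiv_smul, hw₀]
  -- the two places of `E'` below `w₀`, `t w₀` are distinct
  have hne : (t • w₀).under (𝓞 E') ≠ w₀.under (𝓞 E') := by
    intro h
    rcases HeightOneSpectrum.eq_or_eq_smul_of_under_eq h2E hθ h with h' | h'
    · exact htw h'
    · exact htw (h'.trans hθw)
  have key := tprod_fibre_eq h4 ht₀ hθ₀ hθt hθt1 hw₀
    (fun v' => ((asaiLocalPolynomial θ A' η (placeAbove L v')).eval (((v'.residueCard : ℕ) : ℂ) ^ (-z)))⁻¹)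
  beta_reduce at key
  rw [key, if_neg hne, asaiFactor_placeAbove_under h2E hθ,
    asaiFactor_placeAbove_under h2E hθ, asaiLocalPolynomial_of_smul_eq A' η hθw,
    asaiLocalPolynomial_of_smul_eq A' η hθtw]
  -- residue cardinalities: `q_{v'}² = q_{w} = q_v²`
  have hq : ∀ w : HeightOneSpectrum (𝓞 L), θ • w = w → w.under (𝓞 F₀) = v →
      w.asIdeal.inertiaDeg (𝓞 F₀) = 2 → (w.under (𝓞 E')).residueCard = v.residueCard := by
    intro w hw hwv hfw
    have h1 := residueCard_under_sq_of_smul_eq h2E hθ hw (hvE _ (by rw [under_under_place, hwv]))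
    have h2 := residueCard_eq_pow_inertiaDeg (F := F₀) w
    rw [hfw, hwv] at h2
    exact Nat.pow_left_injective two_ne_zero (h1.trans h2)
  rw [hq w₀ hθw hw₀ hf, hq (t • w₀) hθtw htv hft]

/-- **Case `θ ∉ D_{w₀} ≠ 1`** (`t ∈ D` or `θt ∈ D`): the product over the places of `E'` above `v` is
`det(1 - A' w₀ ⊗ A'(θw₀) X²)⁻¹`, `X = q_v^{-z}` (one place `w₀ ∩ E' = tw₀ ∩ E'`, split in `L`, with
`q = q_{w₀} = q_v²`). [folklore] -/
theorem tprod_fibre_of_one (h4 : Module.finrank F₀ L = 4) (h2K : Module.finrank K L = 2)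
    (h2E : Module.finrank E' L = 2) {t : L ≃ₐ[K] L} {θ : L ≃ₐ[E'] L} (ht : t ≠ 1) (hθ : θ ≠ 1)
    (hθt : θ.restrictScalars F₀ ≠ t.restrictScalars F₀)
    (hθt1 : θ.restrictScalars F₀ * t.restrictScalars F₀ ≠ 1)
    {w₀ : HeightOneSpectrum (𝓞 L)} {v : HeightOneSpectrum (𝓞 F₀)} (hw₀ : w₀.under (𝓞 F₀) = v)
    (hvL : Algebra.IsUnramifiedIn (𝓞 L) v.asIdeal)
    (A' : SatakeFamily L) (η : ℤˣ) (z : ℂ) (hθw : θ • w₀ ≠ w₀) (hfix : t • w₀ = w₀ ∨ θ • t • w₀ = w₀) :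
    ∏' v' : {v' : HeightOneSpectrum (𝓞 E') // v'.under (𝓞 F₀) = v},
        ((asaiLocalPolynomial θ A' η (placeAbove L v'.1)).eval (((v'.1.residueCard : ℕ) : ℂ) ^ (-z)))⁻¹ =
      ((satakePairPolynomial (A' w₀) (A' (θ • w₀))).eval ((((v.residueCard : ℕ) : ℂ) ^ (-z)) ^ 2))⁻¹ := by
  obtain ⟨ht₀, hθ₀, htt, hθθ, -⟩ := klein_relations h4 h2K h2E ht hθ hθt hθt1
  have hv₀ : Algebra.IsUnramifiedIn (𝓞 L) (w₀.under (𝓞 F₀)).asIdeal := hw₀ ▸ hvL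
  have hf : w₀.asIdeal.inertiaDeg (𝓞 F₀) = 2 :=
    inertiaDeg_eq_two_of_some_fixed h4 h2K h2E ht hθ hθt hθt1 hv₀
      (hfix.elim Or.inl fun h => Or.inr (Or.inr h))
  -- one place of `E'` below `w₀`, `t w₀`
  have heq : (t • w₀).under (𝓞 E') = w₀.under (𝓞 E') := by
    rcases hfix with h | h
    · rw [h]
    · rw [(smul_smul_eq_iff hθθ w₀).mp h, HeightOneSpectrum.under_algEquiv_smul]
  have key := tprod_fibre_eq h4 ht₀ hθ₀ hθt hθt1 hw₀
    (fun v' => ((asaiLocalPolynomial θ A' η (placeAbove L v')).eval (((v'.residueCard : ℕ) : ℂ) ^ (-z)))⁻¹)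
  beta_reduce at key
  rw [key, if_pos heq, asaiFactor_placeAbove_under h2E hθ,
    asaiLocalPolynomial_of_smul_ne A' η hθw, residueCard_under_of_smul_ne h2E hθw,
    residueCard_eq_pow_inertiaDeg (F := F₀) w₀, hf, hw₀, natCast_sq_cpow_neg]

/-- **Case `D_{w₀} = 1`**: the product over the places of `E'` above `v` is
`det(1 - A' w₀ ⊗ A'(θw₀) X)⁻¹ · det(1 - A'(tw₀) ⊗ A'(θtw₀) X)⁻¹`, `X = q_v^{-z}` (two places, split in
`L`, `q = q_v`). [folklore] -/
theorem tprod_fibre_of_none (h4 : Module.finrank F₀ L = 4) (h2K : Module.finrank K L = 2)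
    (h2E : Module.finrank E' L = 2) {t : L ≃ₐ[K] L} {θ : L ≃ₐ[E'] L} (ht : t ≠ 1) (hθ : θ ≠ 1)
    (hθt : θ.restrictScalars F₀ ≠ t.restrictScalars F₀)
    (hθt1 : θ.restrictScalars F₀ * t.restrictScalars F₀ ≠ 1)
    {w₀ : HeightOneSpectrum (𝓞 L)} {v : HeightOneSpectrum (𝓞 F₀)} (hw₀ : w₀.under (𝓞 F₀) = v)
    (hvL : Algebra.IsUnramifiedIn (𝓞 L) v.asIdeal)
    (A' : SatakeFamily L) (η : ℤˣ) (z : ℂ) (htw : t • w₀ ≠ w₀) (hθw : θ • w₀ ≠ w₀)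
    (hθtw : θ • t • w₀ ≠ w₀) :
    ∏' v' : {v' : HeightOneSpectrum (𝓞 E') // v'.under (𝓞 F₀) = v},
        ((asaiLocalPolynomial θ A' η (placeAbove L v'.1)).eval (((v'.1.residueCard : ℕ) : ℂ) ^ (-z)))⁻¹ =
      ((satakePairPolynomial (A' w₀) (A' (θ • w₀))).eval (((v.residueCard : ℕ) : ℂ) ^ (-z)))⁻¹ *
        ((satakePairPolynomial (A' (t • w₀)) (A' (θ • t • w₀))).eval (((v.residueCard : ℕ) : ℂ) ^ (-z)))⁻¹ := by
  obtain ⟨ht₀, hθ₀, htt, hθθ, hcomm⟩ := klein_relations h4 h2K h2E ht hθ hθt hθt1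
  have hv₀ : Algebra.IsUnramifiedIn (𝓞 L) (w₀.under (𝓞 F₀)).asIdeal := hw₀ ▸ hvL
  have hf : w₀.asIdeal.inertiaDeg (𝓞 F₀) = 1 :=
    inertiaDeg_eq_one_of_none_fixed h4 h2K h2E ht hθ hθt hθt1 hv₀ htw hθw hθtw
  have hft : (t • w₀).asIdeal.inertiaDeg (𝓞 F₀) = 1 := by
    rw [← HeightOneSpectrum.restrictScalars_smul (F := F₀), HeightOneSpectrum.inertiaDeg_algEquiv_smul, hf]
  have htv : (t • w₀).under (𝓞 F₀) = v := by
    rw [← HeightOneSpectrum.restrictScalars_smul (F := F₀), HeightOneSpectrum.under_algEquiv_smul, hw₀]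
  have hθtw' : θ • t • w₀ ≠ t • w₀ := fun h => hθw ((smul_smul_eq_smul_iff hcomm w₀).mp h)
  have hne : (t • w₀).under (𝓞 E') ≠ w₀.under (𝓞 E') := by
    intro h
    rcases HeightOneSpectrum.eq_or_eq_smul_of_under_eq h2E hθ h with h' | h'
    · exact htw h'
    · exact hθtw ((smul_smul_eq_iff hθθ w₀).mpr h')
  have hq : ∀ w : HeightOneSpectrum (𝓞 L), θ • w ≠ w → w.under (𝓞 F₀) = v →
      w.asIdeal.inertiaDeg (𝓞 F₀) = 1 → (w.under (𝓞 E')).residueCard = v.residueCard := by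
    intro w hw hwv hfw
    rw [residueCard_under_of_smul_ne h2E hw, residueCard_eq_pow_inertiaDeg (F := F₀) w, hfw,
      pow_one, hwv]
  have key := tprod_fibre_eq h4 ht₀ hθ₀ hθt hθt1 hw₀
    (fun v' => ((asaiLocalPolynomial θ A' η (placeAbove L v')).eval (((v'.residueCard : ℕ) : ℂ) ^ (-z)))⁻¹)
  beta_reduce at key
  rw [key, if_neg hne, asaiFactor_placeAbove_under h2E hθ,
    asaiFactor_placeAbove_under h2E hθ, asaiLocalPolynomial_of_smul_ne A' η hθw,
    asaiLocalPolynomial_of_smul_ne A' η hθtw', hq w₀ hθw hw₀ hf, hq (t • w₀) hθtw' htv hft]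

end Products

/-- **Registered anchor** of this helper file (stub registry of stmt-Langlands-10902, line
`one-transparent-pane`, chain `stub_asaiPoleInduced` 4/7): `θ • t • w₀ = w₀ ↔ t • w₀ = θ • w₀` for an
involution `θ`, `smul_smul_eq_iff`. [folklore] -/
theorem asaiFibreProducts_anchor : ∀ (F₀ K E' L : Type) [Field F₀] [Field K] [Field E'] [Field L] [NumberField L] [Algebra F₀ K] [Algebra K L] [Algebra F₀ L] [IsScalarTower F₀ K L] [Algebra F₀ E'] [Algebra E' L] [IsScalarTower F₀ E' L] (t : L ≃ₐ[K] L) (θ : L ≃ₐ[E'] L), AlgEquiv.restrictScalars F₀ θ * AlgEquiv.restrictScalars F₀ θ = 1 → ∀ w₀ : HeightOneSpectrum (𝓞 L), θ • t • w₀ = w₀ ↔ t • w₀ = θ • w₀ :=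
  fun _ _ _ _ _ _ _ _ _ _ _ _ _ _ _ _ _ _ hθθ w₀ => smul_smul_eq_iff hθθ w₀

end Summit.Langlands.Langlands.Theorems.HostInducedRep.OneTransparentPane
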